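import Mathlib
import Summits.Ventures.PercRepro2.V2SeriesClosure
import Summits.Ventures.PercRepro2.V2ParallelClosure
import Summits.Ventures.PercRepro2.FlowNat

/-! # (V2) on every series–parallel pattern, at graph level — the dictionary and the theorem
(seat mine-b, cell pub-perc-repro2; conjectures/MINE-B.md §19.5; = the former PatternV2.lean + PatternSP.lean)

A pattern `(ends, s, t, O, Y)` (pinned edges `O`, free edges `Y`) has the configuration poset
`Conf Y = {S // S ⊆ Y}` (blue sets, by inclusion) with the flow labels
`rLabP S = flow (O ∪ (Y ∖ S))` (red) and `bLabP S = flow (O ∪ S)` (blue).  We transport the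
abstract closure theorems of `V2SeriesClosure.lean` / `V2ParallelClosure.lean` to graphs:

* `upDom_of_orderIso`, `harris_of_orderIso` — (V2) and (HC) are invariant under label-preserving
  order isomorphisms;
* `splitIso` — `Conf (Y₁ ∪ Y₂) ≃o Conf Y₁ × Conf Y₂` for disjoint `Y₁`, `Y₂`;
* `labels_series`, `labels_parallel` — under the split, the labels of a series (parallel)
  composition of patterns are the minima (sums) of the parts' labels (`flow_series`,
  `flow_parallel`);
* `upDom_harris_series`, `upDom_harris_parallel` — (V2) ∧ (HC) pass from the parts to the
  composition;
* the atoms `free`, `pin`, `absent` satisfy (V2) ∧ (HC);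
* the atoms `free`, `pin`, `absent` satisfy (V2) ∧ (HC) (their flows are `0` or `1`);
* `IsSP` — patterns built from the atoms by series / parallel composition — and
  `IsSP.upDom`: **(V2) holds on every series–parallel pattern**, at graph level. -/

open Finset
namespace Summit.Ventures.PercRepro2.V2Closure

section Transport

variable {X X' : Type*} [Preorder X] [Preorder X'] [Fintype X] [Fintype X'] [DecidableEq X']

/-- non-negativity on all upper sets transports along an order isomorphism -/
theorem upper_nonneg_of_orderIso (e : X ≃o X') (f : X → ℤ) (f' : X' → ℤ) (hf : ∀ x, f' (e x) = f x)
    (h : ∀ V : Finset X, IsUpperSet (↑V : Set X) → 0 ≤ ∑ x ∈ V, f x) :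
    ∀ V' : Finset X', IsUpperSet (↑V' : Set X') → 0 ≤ ∑ x' ∈ V', f' x' := by
  intro V' hV'
  have hV : IsUpperSet (↑(univ.filter (fun x : X => e x ∈ V')) : Set X) := by
    intro x y hxy hx
    simp only [coe_filter, mem_univ, true_and, Set.mem_setOf_eq] at hx ⊢
    exact hV' (e.monotone hxy) hx
  have := h _ hV
  rw [Finset.sum_filter] at this
  have e1 : ∑ x' ∈ V', f' x' = ∑ x', (if x' ∈ V' then f' x' else 0) := by
    rw [Finset.sum_ite_mem, Finset.univ_inter]
  have e2 : ∑ x', (if x' ∈ V' then f' x' else 0) = ∑ x, (if e x ∈ V' then f x else 0) := by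
    rw [← Fintype.sum_equiv e.toEquiv (fun x => if e x ∈ V' then f x else 0)
      (fun x' => if x' ∈ V' then f' x' else 0)]
    intro x
    simp only [OrderIso.coe_toEquiv, hf]
  rw [e1, e2]; exact this

/-- (V2) transports along a label-preserving order isomorphism -/
theorem upDom_of_orderIso (e : X ≃o X') (r b : X → ℕ) (r' b' : X' → ℕ) (hr : ∀ x, r' (e x) = r x)
    (hb : ∀ x, b' (e x) = b x) (h : UpDom r b) : UpDom r' b' :=
  upper_nonneg_of_orderIso e (nu' r b) (nu' r' b') (fun x => by simp only [nu', hr, hb]) h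

/-- (HC) transports along a label-preserving order isomorphism -/
theorem harris_of_orderIso (e : X ≃o X') (r b : X → ℕ) (r' b' : X' → ℕ) (hr : ∀ x, r' (e x) = r x)
    (hb : ∀ x, b' (e x) = b x) (h : HarrisCond r b) : HarrisCond r' b' := by
  have key := upper_nonneg_of_orderIso e (fun x => indR0 r x - indB0 b x)
    (fun x' => indR0 r' x' - indB0 b' x') (fun x => by simp only [indR0, indB0, hr, hb]) (by
      intro V hV
      have := h V hV
      rw [Finset.sum_sub_distrib]
      exact sub_nonneg.2 this)
  intro V' hV'
  have := key V' hV'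
  rw [Finset.sum_sub_distrib] at this
  exact sub_nonneg.1 this

end Transport

section Patterns

variable {V : Type*} {E : Type*} [DecidableEq E]

/-- The configurations of a pattern with free edges `Y`: the blue sets `S ⊆ Y`. -/
abbrev Conf (Y : Finset E) := {S : Finset E // S ⊆ Y}

/-- The red flow of a configuration: the pins and the red free edges. -/
noncomputable def rLabP (ends : E → Sym2 V) (s t : V) (O Y : Finset E) (S : Conf Y) : ℕ :=
  flow ends s t (O ∪ (Y \ S.1))

/-- The blue flow of a configuration: the pins and the blue free edges. -/
noncomputable def bLabP (ends : E → Sym2 V) (s t : V) (O Y : Finset E) (S : Conf Y) : ℕ :=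
  flow ends s t (O ∪ S.1)

/-- The split of a configuration of `Y₁ ∪ Y₂` into its two halves is an order isomorphism. -/
def splitIso (Y₁ Y₂ : Finset E) (hd : Disjoint Y₁ Y₂) : Conf (Y₁ ∪ Y₂) ≃o Conf Y₁ × Conf Y₂ where
  toFun S := (⟨S.1 ∩ Y₁, Finset.inter_subset_right⟩, ⟨S.1 ∩ Y₂, Finset.inter_subset_right⟩)
  invFun p := ⟨p.1.1 ∪ p.2.1, Finset.union_subset (p.1.2.trans Finset.subset_union_left)
    (p.2.2.trans Finset.subset_union_right)⟩
  left_inv S := by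
    apply Subtype.ext
    simp only
    rw [← Finset.inter_union_distrib_left]
    exact Finset.inter_eq_left.2 S.2
  right_inv p := by
    obtain ⟨⟨A, hA⟩, ⟨B, hB⟩⟩ := p
    simp only [Prod.mk.injEq, Subtype.mk.injEq]
    constructor
    · rw [Finset.union_inter_distrib_right, Finset.inter_eq_left.2 hA,
        Finset.disjoint_iff_inter_eq_empty.1 (Finset.disjoint_of_subset_left hB hd.symm), Finset.union_empty]
    · rw [Finset.union_inter_distrib_right, Finset.inter_eq_left.2 hB,
        Finset.disjoint_iff_inter_eq_empty.1 (Finset.disjoint_of_subset_left hA hd), Finset.empty_union]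
  map_rel_iff' := by
    intro S T
    simp only [Equiv.coe_fn_mk, Prod.mk_le_mk, Subtype.mk_le_mk]
    constructor
    · rintro ⟨h1, h2⟩
      have : S.1 = S.1 ∩ Y₁ ∪ S.1 ∩ Y₂ := by
        rw [← Finset.inter_union_distrib_left]; exact (Finset.inter_eq_left.2 S.2).symm
      rw [show (S ≤ T) = (S.1 ⊆ T.1) from rfl, this]
      exact Finset.union_subset (h1.trans Finset.inter_subset_left) (h2.trans Finset.inter_subset_left)
    · intro h
      exact ⟨Finset.inter_subset_inter h le_rfl, Finset.inter_subset_inter h le_rfl⟩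

/-- the two halves of a union of pieces of disjoint parts -/
lemma inter_union_parts {E₁ E₂ X Z : Finset E} (hdisj : Disjoint E₁ E₂) (hX : X ⊆ E₁) (hZ : Z ⊆ E₂) :
    (X ∪ Z) ∩ E₁ = X ∧ (X ∪ Z) ∩ E₂ = Z := by
  constructor
  · rw [Finset.union_inter_distrib_right, Finset.inter_eq_left.2 hX,
      Finset.disjoint_iff_inter_eq_empty.1 (Finset.disjoint_of_subset_left hZ hdisj.symm), Finset.union_empty]
  · rw [Finset.union_inter_distrib_right, Finset.inter_eq_left.2 hZ,
      Finset.disjoint_iff_inter_eq_empty.1 (Finset.disjoint_of_subset_left hX hdisj), Finset.empty_union]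

/-- the blue set of the composition, as a union of the parts' blue sets -/
lemma blue_union {O₁ O₂ : Finset E} (A B : Finset E) :
    (O₁ ∪ O₂) ∪ (A ∪ B) = (O₁ ∪ A) ∪ (O₂ ∪ B) := by
  ext e; simp only [Finset.mem_union]; tauto

/-- the red set of the composition, as a union of the parts' red sets -/
lemma red_union {O₁ Y₁ O₂ Y₂ : Finset E} (hd : Disjoint Y₁ Y₂) {A B : Finset E} (hA : A ⊆ Y₁)
    (hB : B ⊆ Y₂) :
    (O₁ ∪ O₂) ∪ ((Y₁ ∪ Y₂) \ (A ∪ B)) = (O₁ ∪ (Y₁ \ A)) ∪ (O₂ ∪ (Y₂ \ B)) := by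
  have h1 : (Y₁ ∪ Y₂) \ (A ∪ B) = (Y₁ \ A) ∪ (Y₂ \ B) := by
    ext e
    simp only [Finset.mem_sdiff, Finset.mem_union, not_or]
    constructor
    · rintro ⟨h | h, hA', hB'⟩
      · exact Or.inl ⟨h, hA'⟩
      · exact Or.inr ⟨h, hB'⟩
    · rintro (⟨h, hA'⟩ | ⟨h, hB'⟩)
      · refine ⟨Or.inl h, hA', fun hb => ?_⟩
        exact Finset.disjoint_left.1 hd h (hB hb)
      · refine ⟨Or.inr h, fun ha => ?_, hB'⟩
        exact Finset.disjoint_left.1 hd (hA ha) h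
  rw [h1]
  ext e; simp only [Finset.mem_union]; tauto

/-- **the labels of a series composition are the minima of the parts' labels** (under the split) -/
theorem labels_series {ends : E → Sym2 V} {s v t : V} {O₁ Y₁ O₂ Y₂ : Finset E}
    (hE : SharesOnlyVertex ends v (O₁ ∪ Y₁) (O₂ ∪ Y₂)) (hs : ∀ e ∈ O₂ ∪ Y₂, s ∉ ends e)
    (ht : ∀ e ∈ O₁ ∪ Y₁, t ∉ ends e) (hsv : s ≠ v) (htv : t ≠ v) (hst : s ≠ t)
    (hdisj : Disjoint (O₁ ∪ Y₁) (O₂ ∪ Y₂)) (hdY : Disjoint Y₁ Y₂) (p : Conf Y₁ × Conf Y₂) :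
    rLabP ends s t (O₁ ∪ O₂) (Y₁ ∪ Y₂) ((splitIso Y₁ Y₂ hdY).symm p)
        = serR (rLabP ends s v O₁ Y₁) (rLabP ends v t O₂ Y₂) p ∧
      bLabP ends s t (O₁ ∪ O₂) (Y₁ ∪ Y₂) ((splitIso Y₁ Y₂ hdY).symm p)
        = serB (bLabP ends s v O₁ Y₁) (bLabP ends v t O₂ Y₂) p := by
  obtain ⟨⟨A, hA⟩, ⟨B, hB⟩⟩ := p
  have hinv : ((splitIso Y₁ Y₂ hdY).symm (⟨A, hA⟩, ⟨B, hB⟩)).1 = A ∪ B := rfl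
  constructor
  · unfold rLabP serR
    simp only [hinv]
    have hX : O₁ ∪ (Y₁ \ A) ⊆ O₁ ∪ Y₁ := Finset.union_subset_union le_rfl Finset.sdiff_subset
    have hZ : O₂ ∪ (Y₂ \ B) ⊆ O₂ ∪ Y₂ := Finset.union_subset_union le_rfl Finset.sdiff_subset
    rw [red_union hdY hA hB]
    obtain ⟨e1, e2⟩ := inter_union_parts hdisj hX hZ
    rw [flow_series hE hs ht hsv htv hst hdisj (Finset.union_subset_union hX hZ), e1, e2]
  · unfold bLabP serB
    simp only [hinv]
    have hX : O₁ ∪ A ⊆ O₁ ∪ Y₁ := Finset.union_subset_union le_rfl hA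
    have hZ : O₂ ∪ B ⊆ O₂ ∪ Y₂ := Finset.union_subset_union le_rfl hB
    rw [blue_union (O₁ := O₁) (O₂ := O₂) A B]
    obtain ⟨e1, e2⟩ := inter_union_parts hdisj hX hZ
    rw [flow_series hE hs ht hsv htv hst hdisj (Finset.union_subset_union hX hZ), e1, e2]

/-- **the labels of a parallel composition are the sums of the parts' labels** (under the split) -/
theorem labels_parallel [DecidableEq V] {ends : E → Sym2 V} {s t : V} {O₁ Y₁ O₂ Y₂ : Finset E}
    (hE : SharesOnlyPair ends s t (O₁ ∪ Y₁) (O₂ ∪ Y₂)) (hst : s ≠ t)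
    (hdisj : Disjoint (O₁ ∪ Y₁) (O₂ ∪ Y₂)) (hdY : Disjoint Y₁ Y₂) (p : Conf Y₁ × Conf Y₂) :
    rLabP ends s t (O₁ ∪ O₂) (Y₁ ∪ Y₂) ((splitIso Y₁ Y₂ hdY).symm p)
        = parR (rLabP ends s t O₁ Y₁) (rLabP ends s t O₂ Y₂) p ∧
      bLabP ends s t (O₁ ∪ O₂) (Y₁ ∪ Y₂) ((splitIso Y₁ Y₂ hdY).symm p)
        = parB (bLabP ends s t O₁ Y₁) (bLabP ends s t O₂ Y₂) p := by
  obtain ⟨⟨A, hA⟩, ⟨B, hB⟩⟩ := p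
  have hinv : ((splitIso Y₁ Y₂ hdY).symm (⟨A, hA⟩, ⟨B, hB⟩)).1 = A ∪ B := rfl
  constructor
  · unfold rLabP parR
    simp only [hinv]
    have hX : O₁ ∪ (Y₁ \ A) ⊆ O₁ ∪ Y₁ := Finset.union_subset_union le_rfl Finset.sdiff_subset
    have hZ : O₂ ∪ (Y₂ \ B) ⊆ O₂ ∪ Y₂ := Finset.union_subset_union le_rfl Finset.sdiff_subset
    rw [red_union hdY hA hB]
    obtain ⟨e1, e2⟩ := inter_union_parts hdisj hX hZ
    rw [flow_parallel hE hst hdisj (Finset.union_subset_union hX hZ), e1, e2]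
  · unfold bLabP parB
    simp only [hinv]
    have hX : O₁ ∪ A ⊆ O₁ ∪ Y₁ := Finset.union_subset_union le_rfl hA
    have hZ : O₂ ∪ B ⊆ O₂ ∪ Y₂ := Finset.union_subset_union le_rfl hB
    rw [blue_union (O₁ := O₁) (O₂ := O₂) A B]
    obtain ⟨e1, e2⟩ := inter_union_parts hdisj hX hZ
    rw [flow_parallel hE hst hdisj (Finset.union_subset_union hX hZ), e1, e2]

/-- **(V2) ∧ (HC) pass to a series composition of patterns** -/
theorem upDom_harris_series [Fintype E] {ends : E → Sym2 V} {s v t : V} {O₁ Y₁ O₂ Y₂ : Finset E}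
    (hE : SharesOnlyVertex ends v (O₁ ∪ Y₁) (O₂ ∪ Y₂)) (hs : ∀ e ∈ O₂ ∪ Y₂, s ∉ ends e)
    (ht : ∀ e ∈ O₁ ∪ Y₁, t ∉ ends e) (hsv : s ≠ v) (htv : t ≠ v) (hst : s ≠ t)
    (hdisj : Disjoint (O₁ ∪ Y₁) (O₂ ∪ Y₂)) (hdY : Disjoint Y₁ Y₂)
    (h₁ : UpDom (rLabP ends s v O₁ Y₁) (bLabP ends s v O₁ Y₁) ∧
      HarrisCond (rLabP ends s v O₁ Y₁) (bLabP ends s v O₁ Y₁))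
    (h₂ : UpDom (rLabP ends v t O₂ Y₂) (bLabP ends v t O₂ Y₂) ∧
      HarrisCond (rLabP ends v t O₂ Y₂) (bLabP ends v t O₂ Y₂)) :
    UpDom (rLabP ends s t (O₁ ∪ O₂) (Y₁ ∪ Y₂)) (bLabP ends s t (O₁ ∪ O₂) (Y₁ ∪ Y₂)) ∧
      HarrisCond (rLabP ends s t (O₁ ∪ O₂) (Y₁ ∪ Y₂)) (bLabP ends s t (O₁ ∪ O₂) (Y₁ ∪ Y₂)) := by
  have hl := labels_series hE hs ht hsv htv hst hdisj hdY
  exact ⟨upDom_of_orderIso (splitIso Y₁ Y₂ hdY).symm _ _ _ _ (fun p => (hl p).1) (fun p => (hl p).2)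
      (upDom_ser _ _ _ _ h₁.1 h₂.1),
    harris_of_orderIso (splitIso Y₁ Y₂ hdY).symm _ _ _ _ (fun p => (hl p).1) (fun p => (hl p).2)
      (harris_ser _ _ _ _ h₁.2 h₂.2)⟩

/-- **(V2) ∧ (HC) pass to a parallel composition of patterns** -/
theorem upDom_harris_parallel [DecidableEq V] [Fintype E] {ends : E → Sym2 V} {s t : V} {O₁ Y₁ O₂ Y₂ : Finset E}
    (hE : SharesOnlyPair ends s t (O₁ ∪ Y₁) (O₂ ∪ Y₂)) (hst : s ≠ t)
    (hdisj : Disjoint (O₁ ∪ Y₁) (O₂ ∪ Y₂)) (hdY : Disjoint Y₁ Y₂)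
    (h₁ : UpDom (rLabP ends s t O₁ Y₁) (bLabP ends s t O₁ Y₁) ∧
      HarrisCond (rLabP ends s t O₁ Y₁) (bLabP ends s t O₁ Y₁))
    (h₂ : UpDom (rLabP ends s t O₂ Y₂) (bLabP ends s t O₂ Y₂) ∧
      HarrisCond (rLabP ends s t O₂ Y₂) (bLabP ends s t O₂ Y₂)) :
    UpDom (rLabP ends s t (O₁ ∪ O₂) (Y₁ ∪ Y₂)) (bLabP ends s t (O₁ ∪ O₂) (Y₁ ∪ Y₂)) ∧
      HarrisCond (rLabP ends s t (O₁ ∪ O₂) (Y₁ ∪ Y₂)) (bLabP ends s t (O₁ ∪ O₂) (Y₁ ∪ Y₂)) := by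
  have hl := labels_parallel hE hst hdisj hdY
  exact ⟨upDom_of_orderIso (splitIso Y₁ Y₂ hdY).symm _ _ _ _ (fun p => (hl p).1) (fun p => (hl p).2)
      (upDom_par _ _ _ _ h₁.1 h₂.1 h₁.2 h₂.2),
    harris_of_orderIso (splitIso Y₁ Y₂ hdY).symm _ _ _ _ (fun p => (hl p).1) (fun p => (hl p).2)
      (harris_par _ _ _ _ h₁.2 h₂.2)⟩

end Patterns





section Atoms

variable {V : Type*} {E : Type*} [DecidableEq E]

/-- the flow of the empty edge set is `0` -/
lemma flow_empty (ends : E → Sym2 V) (s t : V) : flow ends s t ∅ = 0 := by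
  unfold flow
  classical
  exact Nat.le_zero.1 (le_trans (Nat.findGreatest_le _) (by simp))

/-- a single edge joining `s ≠ t` carries flow exactly `1` -/
lemma flow_single {ends : E → Sym2 V} {s t : V} (hst : s ≠ t) {f : E} (hf : ends f = s(s, t)) :
    flow ends s t {f} = 1 := by
  apply le_antisymm
  · have := @Nat.findGreatest_le (fun k => kDisj (fun S => Carries ends S s t) k ({f} : Finset E))
      (Classical.decPred _) ({f} : Finset E).card
    unfold flow
    simpa using this
  · apply le_flow hst
    refine ⟨{f}, ∅, le_rfl, Finset.empty_subset _, Finset.disjoint_empty_right _, ?_, fun _ _ => trivial⟩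
    intro T hT
    exact conn_of_openAdj ⟨f, ofFinset_eq_true_iff.2 (hT (Finset.mem_singleton_self f)), hf⟩

omit [DecidableEq E] in
/-- a configuration of the empty free set is empty -/
lemma conf_empty_eq (S : Conf (∅ : Finset E)) : S.1 = ∅ := Finset.subset_empty.1 S.2

/-- the absent edge: flows `(0, 0)` -/
theorem absent_atom [Fintype E] (ends : E → Sym2 V) (s t : V) :
    UpDom (rLabP ends s t ∅ ∅) (bLabP ends s t ∅ ∅) ∧ HarrisCond (rLabP ends s t ∅ ∅) (bLabP ends s t ∅ ∅) := by
  have hr : ∀ S : Conf (∅ : Finset E), rLabP ends s t ∅ ∅ S = 0 := by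
    intro S; unfold rLabP; rw [conf_empty_eq S]; simp [flow_empty]
  have hb : ∀ S : Conf (∅ : Finset E), bLabP ends s t ∅ ∅ S = 0 := by
    intro S; unfold bLabP; rw [conf_empty_eq S]; simp [flow_empty]
  constructor
  · intro W _
    apply Finset.sum_nonneg; intro S _
    simp [nu', hr, hb]
  · intro W _
    apply Finset.sum_le_sum; intro S _
    simp [hr, hb]

/-- the pinned edge: flows `(1, 1)` -/
theorem pin_atom [Fintype E] {ends : E → Sym2 V} {s t : V} (hst : s ≠ t) {f : E} (hf : ends f = s(s, t)) :
    UpDom (rLabP ends s t {f} ∅) (bLabP ends s t {f} ∅) ∧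
      HarrisCond (rLabP ends s t {f} ∅) (bLabP ends s t {f} ∅) := by
  have hr : ∀ S : Conf (∅ : Finset E), rLabP ends s t {f} ∅ S = 1 := by
    intro S; unfold rLabP; rw [conf_empty_eq S]; simp [flow_single hst hf]
  have hb : ∀ S : Conf (∅ : Finset E), bLabP ends s t {f} ∅ S = 1 := by
    intro S; unfold bLabP; rw [conf_empty_eq S]; simp [flow_single hst hf]
  constructor
  · intro W _
    apply Finset.sum_nonneg; intro S _
    simp [nu', hr, hb]
  · intro W _
    apply Finset.sum_le_sum; intro S _
    simp [hr, hb]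

omit [DecidableEq E] in
/-- a configuration of a single free edge is `∅` or `{f}` -/
lemma conf_single_cases {f : E} (S : Conf ({f} : Finset E)) : S.1 = ∅ ∨ S.1 = {f} :=
  Finset.subset_singleton_iff.1 S.2

/-- the free edge: flows `(1, 0)` on the red state and `(0, 1)` on the blue state -/
theorem free_atom [Fintype E] {ends : E → Sym2 V} {s t : V} (hst : s ≠ t) {f : E} (hf : ends f = s(s, t)) :
    UpDom (rLabP ends s t ∅ {f}) (bLabP ends s t ∅ {f}) ∧
      HarrisCond (rLabP ends s t ∅ {f}) (bLabP ends s t ∅ {f}) := by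
  have hr : ∀ S : Conf ({f} : Finset E), rLabP ends s t ∅ {f} S = if S.1 = ∅ then 1 else 0 := by
    intro S; unfold rLabP
    rcases conf_single_cases S with h | h <;> rw [h] <;> simp [flow_single hst hf, flow_empty]
  have hb : ∀ S : Conf ({f} : Finset E), bLabP ends s t ∅ {f} S = if S.1 = ∅ then 0 else 1 := by
    intro S; unfold bLabP
    rcases conf_single_cases S with h | h <;> rw [h] <;> simp [flow_single hst hf, flow_empty]
  constructor
  · intro W _
    apply Finset.sum_nonneg; intro S _
    rw [nu', hr, hb]
    split_ifs <;> omega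
  · intro W hW
    simp only [hr, hb]
    -- the two states
    set e0 : Conf ({f} : Finset E) := ⟨∅, Finset.empty_subset _⟩ with he0
    set e1 : Conf ({f} : Finset E) := ⟨{f}, le_rfl⟩ with he1
    have k0 : ∀ S : Conf ({f} : Finset E), (if (if S.1 = ∅ then (0:ℕ) else 1) = 0 then (1:ℤ) else 0)
        = if S = e0 then 1 else 0 := by
      intro S
      rcases conf_single_cases S with h | h
      · have : S = e0 := Subtype.ext h
        simp [this, he0]
      · have : S ≠ e0 := fun hS => by rw [hS] at h; simp [he0] at h
        simp [h, this]
    have k1 : ∀ S : Conf ({f} : Finset E), (if (if S.1 = ∅ then (1:ℕ) else 0) = 0 then (1:ℤ) else 0)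
        = if S = e1 then 1 else 0 := by
      intro S
      rcases conf_single_cases S with h | h
      · have : S ≠ e1 := fun hS => by rw [hS] at h; simp [he1] at h
        simp [h, this]
      · have : S = e1 := Subtype.ext h
        simp [this, he1]
    simp only [k0, k1, Finset.sum_ite_eq']
    by_cases h0 : e0 ∈ W
    · have h1 : e1 ∈ W := hW (show e0 ≤ e1 from Finset.empty_subset _) h0
      simp [h0, h1]
    · simp [h0]
      split_ifs <;> simp

end Atoms

section SP

variable {V : Type*} {E : Type*} [DecidableEq V] [DecidableEq E] [Fintype E]

/-- **Series–parallel patterns**: built from the three atoms by series composition at a cut vertex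
and parallel composition at the terminals (parts edge-disjoint, sharing only the glue). -/
inductive IsSP (ends : E → Sym2 V) : V → V → Finset E → Finset E → Prop
  | free {s t : V} {f : E} (hst : s ≠ t) (hf : ends f = s(s, t)) : IsSP ends s t ∅ {f}
  | pin {s t : V} {f : E} (hst : s ≠ t) (hf : ends f = s(s, t)) : IsSP ends s t {f} ∅
  | absent {s t : V} : IsSP ends s t ∅ ∅
  | ser {s v t : V} {O₁ Y₁ O₂ Y₂ : Finset E} (h₁ : IsSP ends s v O₁ Y₁) (h₂ : IsSP ends v t O₂ Y₂)
      (hE : SharesOnlyVertex ends v (O₁ ∪ Y₁) (O₂ ∪ Y₂)) (hs : ∀ e ∈ O₂ ∪ Y₂, s ∉ ends e)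
      (ht : ∀ e ∈ O₁ ∪ Y₁, t ∉ ends e) (hsv : s ≠ v) (htv : t ≠ v) (hst : s ≠ t)
      (hdisj : Disjoint (O₁ ∪ Y₁) (O₂ ∪ Y₂)) (hdY : Disjoint Y₁ Y₂) :
      IsSP ends s t (O₁ ∪ O₂) (Y₁ ∪ Y₂)
  | par {s t : V} {O₁ Y₁ O₂ Y₂ : Finset E} (h₁ : IsSP ends s t O₁ Y₁) (h₂ : IsSP ends s t O₂ Y₂)
      (hE : SharesOnlyPair ends s t (O₁ ∪ Y₁) (O₂ ∪ Y₂)) (hst : s ≠ t)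
      (hdisj : Disjoint (O₁ ∪ Y₁) (O₂ ∪ Y₂)) (hdY : Disjoint Y₁ Y₂) :
      IsSP ends s t (O₁ ∪ O₂) (Y₁ ∪ Y₂)

/-- **(V2) ∧ (HC) on every series–parallel pattern** (induction over the construction). -/
theorem IsSP.upDom_harris {ends : E → Sym2 V} {s t : V} {O Y : Finset E} (h : IsSP ends s t O Y) :
    UpDom (rLabP ends s t O Y) (bLabP ends s t O Y) ∧ HarrisCond (rLabP ends s t O Y) (bLabP ends s t O Y) := by
  induction h with
  | free hst hf => exact free_atom hst hf
  | pin hst hf => exact pin_atom hst hf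
  | absent => exact absent_atom ends _ _
  | ser _ _ hE hs ht hsv htv hst hdisj hdY ih₁ ih₂ =>
      exact upDom_harris_series hE hs ht hsv htv hst hdisj hdY ih₁ ih₂
  | par _ _ hE hst hdisj hdY ih₁ ih₂ =>
      exact upDom_harris_parallel hE hst hdisj hdY ih₁ ih₂

/-- **The Hall form (V2) of (U) holds on every series–parallel pattern**: every upper set of the
configuration poset carries non-negative `ν′`-mass for the flow labels. -/
theorem IsSP.upDom {ends : E → Sym2 V} {s t : V} {O Y : Finset E} (h : IsSP ends s t O Y) :
    UpDom (rLabP ends s t O Y) (bLabP ends s t O Y) :=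
  h.upDom_harris.1

/-- The count (U′) of a series–parallel pattern is non-negative. -/
theorem IsSP.sum_nu'_nonneg {ends : E → Sym2 V} {s t : V} {O Y : Finset E} (h : IsSP ends s t O Y) :
    0 ≤ ∑ S : Conf Y, nu' (rLabP ends s t O Y) (bLabP ends s t O Y) S :=
  h.upDom univ (by simp [isUpperSet_univ])

end SP

end Summit.Ventures.PercRepro2.V2Closure
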